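import Mathlib
import HarnessLib
import Summits.HubbardSuperconductivity.HubbardSuperconductivity.Theorems.KLProgrammeKLRegimeCountertermJacksonRemainderLocal
import Literature.Analysis.Calculus.IteratedFDerivParametricIntegral

/-!
# Route `KLProgramme`, crux K3 — gen-8 ENGINE-FLOW child (stmt-HubbardSuperconductivity-20437 `KLRegimeEngineV17F2`), stub (C)
# `stub_twoLeg_curvature`: the (C1) JACKSON-REMAINDER DOOR v2 — jets of `θ ↦ (F − 𝒥_d F)(γ(θ))` by differentiating ALONG THE CURVE
# under the smoothing integral

Seat hubbard-kl-k3c3-p1 (g6).  The v1 door (`jacksonRemainder_curve_jets`) bounds the CARTESIAN derivatives of the remainder at the curve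
point and composes with the curve afterwards, so its far term carries the GLOBAL Cartesian sizes of `F = klFrameExtFn μ f` (huge in the
cutoff zone).  Here the order is reversed: with `G := F ∘ ofLp`, `v_w := jshift w`, for `k ≤ 4`,
  `∂ᵏ[(F − 𝒥_dF) ∘ ofLp ∘ γ](θ) = −∫ J̃J̃(w) · (∂ᵏ[ϑ ↦ G(γϑ − v_w)](θ) − ∂ᵏ[G ∘ γ](θ)) dμ(w)`,
so every bound reads ALONG-CURVE jets of `G` on the displaced curves `γ − v_w` (k3c3-p3's `…FlowShellJets`) and of `G ∘ γ` (`= f` on the tube).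
* §1 `contDiff_integral_of_continuous_family`: finite-order differentiation under the integral sign for a family of `Cᵐ` maps on a proper
  parameter space with JOINTLY CONTINUOUS derivatives, against a finite measure carried by a compact set (domination is automatic on compact
  neighbourhoods; generalises k3c3-p2's `contDiff_integral_translate` beyond translates);
* §2 the along-curve family (one jointly `C⁴` function `(v, ϑ) ↦ G(γϑ − v)` evaluated along affine maps), **`iteratedDeriv_jhigh1_comp_curve_eq'`**
  (the displayed formula; hypothesis-free twin of k3c3-p3's p540131 version), `contDiff_jhigh1_comp_curve'`;
* §3 **`abs_iteratedDeriv_jhigh1_comp_curve_le_integral`** (MAJORANT form `|∂ᵏR(θ)| ≤ ∫ J̃J̃·maj`) and **`abs_iteratedDeriv_jhigh1_comp_curve_le_split`**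
  (near/far bookkeeping `A·m₁ + C + S·π³/((d+1)δ)³` from a near majorant `A(|s|+|t|) + C` on `|s|,|t| ≤ δ` and a far majorant `S`).
Pure real analysis; no definitions; nothing about the model.  [Hörmander, ALPDO I, Thm 1.1.9; folklore]
-/

noncomputable section

namespace Summit.HubbardSuperconductivity.HubbardSuperconductivity.Theorems.KLRegimeSplit

set_option linter.dupNamespace false -- summit = problem name (single-conjunct summit), D-0017

open Real MeasureTheory Filter Metric Function
open scoped Topology ContDiff
open Literature.Analysis.Fourier.TrigApprox Literature.MathematicalPhysics.QuantumLattice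

/-! ## §1 Finite-order differentiation under the integral sign for a jointly continuous family -/

section Family

variable {P : Type*} [NormedAddCommGroup P] [NormedSpace ℝ P] [ProperSpace P]
variable {μ : Measure (ℝ × ℝ)} [IsFiniteMeasure μ]

/-- **Finite-order dominated differentiation for a jointly continuous family.**  Let `μ` be a finite measure on `ℝ × ℝ` carried by a
compact set `K`, and `N w : P → ℝ` (`P` proper) a family of `Cᵐ` maps whose derivatives `(w, x) ↦ Dⁱ(N w)(x)`, `i ≤ m`, are jointly
continuous.  Then `x ↦ ∫ N w x dμ` is `Cᵐ` and `Dʲ(∫ N w dμ)(x) = ∫ Dʲ(N w)(x) dμ` for `j ≤ m`. [folklore] -/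
theorem contDiff_integral_of_continuous_family {K : Set (ℝ × ℝ)} (hK : IsCompact K) (hμK : ∀ᵐ w ∂μ, w ∈ K)
    {N : ℝ × ℝ → P → ℝ} {m : ℕ} (hs : ∀ w, ContDiff ℝ m (N w))
    (hcont2 : ∀ i ≤ m, Continuous fun q : (ℝ × ℝ) × P => iteratedFDeriv ℝ i (N q.1) q.2) :
    ContDiff ℝ m (fun x => ∫ w, N w x ∂μ) ∧
      ∀ j ≤ m, ∀ x, iteratedFDeriv ℝ j (fun x => ∫ w, N w x ∂μ) x = ∫ w, iteratedFDeriv ℝ j (N w) x ∂μ := by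
  -- local uniform bounds from joint continuity on the compact `K × closedBall x₀ 1`
  have hloc : ∀ i ≤ m, ∀ x₀ : P, ∃ C : ℝ, ∀ w ∈ K, ∀ x ∈ closedBall x₀ 1, ‖iteratedFDeriv ℝ i (N w) x‖ ≤ C := by
    intro i hi x₀
    obtain ⟨C, hC⟩ := (hK.prod (isCompact_closedBall x₀ 1)).exists_bound_of_continuousOn ((hcont2 i hi).continuousOn)
    exact ⟨C, fun w hw x hx => hC (w, x) ⟨hw, hx⟩⟩
  -- the candidate derivatives
  let Bf : (i : ℕ) → P → P [×i]→L[ℝ] ℝ := fun i x => ∫ w, iteratedFDeriv ℝ i (N w) x ∂μ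
  let L : (i : ℕ) → (P [×(i + 1)]→L[ℝ] ℝ) ≃ₗᵢ[ℝ] (P →L[ℝ] P [×i]→L[ℝ] ℝ) := fun i =>
    continuousMultilinearCurryLeftEquiv ℝ (fun _ : Fin (i + 1) => P) ℝ
  have hmeas : ∀ i ≤ m, ∀ x, AEStronglyMeasurable (fun w => iteratedFDeriv ℝ i (N w) x) μ := fun i hi x =>
    ((hcont2 i hi).comp (Continuous.prodMk_left x)).aestronglyMeasurable
  have hint : ∀ i ≤ m, ∀ x, Integrable (fun w => iteratedFDeriv ℝ i (N w) x) μ := by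
    intro i hi x
    obtain ⟨C, hC⟩ := hloc i hi x
    exact (integrable_const C).mono' (hmeas i hi x)
      (hμK.mono fun w hw => hC w hw x (mem_closedBall_self zero_le_one))
  -- one derivative under the integral sign
  have hQ : ∀ i, i + 1 ≤ m → ∀ x, HasFDerivAt (Bf i) (L i (Bf (i + 1) x)) x := by
    intro i hi x
    have hi' : i ≤ m := (Nat.le_succ i).trans hi
    obtain ⟨C, hC⟩ := hloc (i + 1) hi x
    have hdiff : ∀ w y, HasFDerivAt (fun y => iteratedFDeriv ℝ i (N w) y)
        (fderiv ℝ (iteratedFDeriv ℝ i (N w)) y) y := fun w y =>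
      (((hs w).differentiable_iteratedFDeriv (m := i) (by exact_mod_cast Nat.lt_of_succ_le hi)) y).hasFDerivAt
    have hF'm : AEStronglyMeasurable (fun w => fderiv ℝ (iteratedFDeriv ℝ i (N w)) x) μ := by
      have : (fun w => fderiv ℝ (iteratedFDeriv ℝ i (N w)) x) =
          fun w => L i (iteratedFDeriv ℝ (i + 1) (N w) x) := by
        funext w; rfl
      rw [this]
      exact (L i).continuous.comp_aestronglyMeasurable (hmeas (i + 1) hi x)
    have h := hasFDerivAt_integral_of_dominated_of_fderiv_le (μ := μ)
      (F := fun y w => iteratedFDeriv ℝ i (N w) y)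
      (F' := fun y w => fderiv ℝ (iteratedFDeriv ℝ i (N w)) y) (bound := fun _ => C)
      (ball_mem_nhds x zero_lt_one) (Eventually.of_forall fun y => hmeas i hi' y) (hint i hi' x) hF'm
      (hμK.mono fun w hw y hy => by
        rw [norm_fderiv_iteratedFDeriv]; exact hC w hw y (ball_subset_closedBall hy))
      (integrable_const C) (Eventually.of_forall fun w y _ => hdiff w y)
    have hval : (∫ w, fderiv ℝ (iteratedFDeriv ℝ i (N w)) x ∂μ) = L i (Bf (i + 1) x) := by
      show (∫ w, (L i).toLinearIsometry (iteratedFDeriv ℝ (i + 1) (N w) x) ∂μ) = _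
      exact LinearIsometry.integral_comp_comm (X := ℝ × ℝ) (μ := μ) (𝕜 := ℝ) (E := P [×(i + 1)]→L[ℝ] ℝ)
        (F := P →L[ℝ] P [×i]→L[ℝ] ℝ) (L i).toLinearIsometry _
    rwa [hval] at h
  -- continuity of every `Bf i`, `i ≤ m` (dominated continuity on compact neighbourhoods)
  have hcont : ∀ i ≤ m, Continuous (Bf i) := by
    intro i hi
    refine continuous_iff_continuousAt.2 fun x₀ => ?_
    obtain ⟨C, hC⟩ := hloc i hi x₀
    exact continuousAt_of_dominated (Eventually.of_forall fun x => hmeas i hi x)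
      ((eventually_of_mem (closedBall_mem_nhds x₀ zero_lt_one) fun x hx => hμK.mono fun w hw => hC w hw x hx))
      (integrable_const C)
      (Eventually.of_forall fun w => ((hs w).continuous_iteratedFDeriv (m := i) (by exact_mod_cast hi)).continuousAt)
  -- `Bf i ∈ C^j` whenever `i + j ≤ m`
  have hS : ∀ j i, i + j ≤ m → ContDiff ℝ j (Bf i) := by
    intro j
    induction j with
    | zero => intro i hi; exact contDiff_zero.2 (hcont i (by omega))
    | succ j ih =>
      intro i hi
      have hi1 : i + 1 ≤ m := by omega
      have hd : ∀ x, HasFDerivAt (Bf i) (L i (Bf (i + 1) x)) x := hQ i hi1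
      have hfd : fderiv ℝ (Bf i) = fun x => L i (Bf (i + 1) x) := funext fun x => (hd x).fderiv
      rw [show ((j + 1 : ℕ) : WithTop ℕ∞) = (j : WithTop ℕ∞) + 1 by push_cast; ring,
        contDiff_succ_iff_fderiv]
      refine ⟨fun x => (hd x).differentiableAt, fun h => absurd h (by simp), ?_⟩
      rw [hfd]
      exact (LinearIsometryEquiv.contDiff (E := P [×(i + 1)]→L[ℝ] ℝ)
        (F := P →L[ℝ] P [×i]→L[ℝ] ℝ) (L i)).comp (ih (i + 1) (by omega))
  -- the integral itself
  have hf : (fun x => ∫ w, N w x ∂μ) = fun x => (continuousMultilinearCurryFin0 ℝ P ℝ) (Bf 0 x) := by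
    funext x
    have : Bf 0 x = ∫ w, (continuousMultilinearCurryFin0 ℝ P ℝ).symm.toLinearIsometry (N w x) ∂μ := rfl
    rw [this, LinearIsometry.integral_comp_comm (X := ℝ × ℝ) (μ := μ) (𝕜 := ℝ) (E := ℝ)
      (F := P [×0]→L[ℝ] ℝ)]
    simp
  have hR : ∀ j ≤ m, iteratedFDeriv ℝ j (fun x => ∫ w, N w x ∂μ) = Bf j := by
    intro j
    induction j with
    | zero =>
      intro _
      funext x
      rw [iteratedFDeriv_zero_eq_comp, Function.comp_apply,
        show (∫ w, N w x ∂μ) = continuousMultilinearCurryFin0 ℝ P ℝ (Bf 0 x) from congrFun hf x]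
      simp
    | succ j ih =>
      intro hj
      have hfd : fderiv ℝ (Bf j) = fun x => L j (Bf (j + 1) x) :=
        funext fun x => (hQ j hj x).fderiv
      rw [iteratedFDeriv_succ_eq_comp_left, ih ((Nat.le_succ j).trans hj), hfd]
      funext x
      simp only [Function.comp_apply, L, LinearIsometryEquiv.symm_apply_apply]
  refine ⟨?_, fun j hj x => ?_⟩
  · show ContDiff ℝ m (fun x => ∫ w, N w x ∂μ)
    rw [hf]
    exact (LinearIsometryEquiv.contDiff (E := P [×0]→L[ℝ] ℝ) (F := ℝ)
      (continuousMultilinearCurryFin0 ℝ P ℝ)).comp (hS m 0 (by omega))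
  · show iteratedFDeriv ℝ j (fun x => ∫ w, N w x ∂μ) x = _
    rw [hR j hj]

omit [ProperSpace P] in
/-- Joint continuity of the derivatives gives continuity in the parameter at a fixed point (stated for an abstract family so that the
instantiation at a concrete integrand is a β-reduction, not a definitional unfolding). -/
theorem continuous_iteratedFDeriv_family_left {N : ℝ × ℝ → P → ℝ} {i : ℕ}
    (h : Continuous fun q : (ℝ × ℝ) × P => iteratedFDeriv ℝ i (N q.1) q.2) (x : P) :
    Continuous fun w => iteratedFDeriv ℝ i (N w) x :=
  h.comp (Continuous.prodMk_left x)

end Family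

/-! ## §2 The along-curve family: `ϑ ↦ J̃J̃(w)·G(γϑ − v_w)` and the exact formula for the remainder's jets along the curve -/

section Curve

variable (d : ℕ) {F : (Fin 2 → ℝ) → ℝ} {γ : ℝ → EuclideanSpace ℝ (Fin 2)}

/-- The smoothing square's measure is carried by the closed square `[−π, π]²`. -/
theorem ae_jmeas_mem_Icc : ∀ᵐ w ∂jmeas, w ∈ Set.Icc (-π) π ×ˢ Set.Icc (-π) π := by
  have h : ∀ᵐ w ∂jmeas, w ∈ Set.Ioc (-π) π ×ˢ Set.Ioc (-π) π := by
    rw [jmeas_eq_restrict]; exact ae_restrict_mem (measurableSet_Ioc.prod measurableSet_Ioc)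
  exact h.mono fun w hw => ⟨Set.Ioc_subset_Icc_self hw.1, Set.Ioc_subset_Icc_self hw.2⟩

/-- The closed square `[−π, π]²` is compact. -/
theorem isCompact_jsquare : IsCompact (Set.Icc (-π) π ×ˢ Set.Icc (-π) π : Set (ℝ × ℝ)) := isCompact_Icc.prod isCompact_Icc

/-- The jointly `C⁴` master function `(v, ϑ) ↦ G(γϑ − v)` on `ℝ² × ℝ`. -/
theorem contDiff_curveTranslate (hG : ContDiff ℝ 4 (fun q : EuclideanSpace ℝ (Fin 2) => F (WithLp.ofLp q))) (hγ : ContDiff ℝ 4 γ) :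
    ContDiff ℝ 4 (fun z : EuclideanSpace ℝ (Fin 2) × ℝ => F (WithLp.ofLp (γ z.2 - z.1))) :=
  hG.comp ((hγ.comp contDiff_snd).sub contDiff_fst)
/-- Each displaced composite `ϑ ↦ G(γϑ − v)` is `C⁴`. -/
theorem contDiff_comp_curve_sub (hG : ContDiff ℝ 4 (fun q : EuclideanSpace ℝ (Fin 2) => F (WithLp.ofLp q))) (hγ : ContDiff ℝ 4 γ)
    (v : EuclideanSpace ℝ (Fin 2)) : ContDiff ℝ 4 (fun ϑ : ℝ => F (WithLp.ofLp (γ ϑ - v))) := hG.comp (hγ.sub contDiff_const)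

/-- The displaced composite as the master function along an affine map: `G(γϑ − v) = Φ(inr ϑ + (v, 0))`. -/
theorem comp_curve_sub_eq_affine (v : EuclideanSpace ℝ (Fin 2)) :
    (fun ϑ : ℝ => F (WithLp.ofLp (γ ϑ - v))) =
      fun ϑ : ℝ => (fun z : EuclideanSpace ℝ (Fin 2) × ℝ => F (WithLp.ofLp (γ z.2 - z.1)))
        ((ContinuousLinearMap.inr ℝ (EuclideanSpace ℝ (Fin 2)) ℝ) ϑ + (v, 0)) := by funext ϑ; simp

/-- **Iterated derivatives of the displaced composite** through the master function: `Dⁱ[ϑ ↦ G(γϑ − v)](ϑ) = DⁱΦ(v, ϑ) ∘ (inr, …, inr)`. -/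
theorem iteratedFDeriv_comp_curve_sub_eq (hG : ContDiff ℝ 4 (fun q : EuclideanSpace ℝ (Fin 2) => F (WithLp.ofLp q))) (hγ : ContDiff ℝ 4 γ)
    (v : EuclideanSpace ℝ (Fin 2)) {i : ℕ} (hi : i ≤ 4) (ϑ : ℝ) :
    iteratedFDeriv ℝ i (fun ϑ : ℝ => F (WithLp.ofLp (γ ϑ - v))) ϑ =
      (iteratedFDeriv ℝ i (fun z : EuclideanSpace ℝ (Fin 2) × ℝ => F (WithLp.ofLp (γ z.2 - z.1)))
        ((ContinuousLinearMap.inr ℝ (EuclideanSpace ℝ (Fin 2)) ℝ) ϑ + (v, 0))).compContinuousLinearMap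
        fun _ => ContinuousLinearMap.inr ℝ (EuclideanSpace ℝ (Fin 2)) ℝ := by
  rw [comp_curve_sub_eq_affine]
  exact Literature.Analysis.Calculus.iteratedFDeriv_comp_affine (contDiff_curveTranslate hG hγ) _ _ (by exact_mod_cast hi) ϑ

/-- **Joint continuity** of `(w, ϑ) ↦ Dⁱ[ϑ ↦ J̃J̃(w)·G(γϑ − v_w)](ϑ)`, `i ≤ 4`. -/
theorem continuous_iteratedFDeriv_curveFamily (hG : ContDiff ℝ 4 (fun q : EuclideanSpace ℝ (Fin 2) => F (WithLp.ofLp q)))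
    (hγ : ContDiff ℝ 4 γ) {i : ℕ} (hi : i ≤ 4) :
    Continuous fun q : (ℝ × ℝ) × ℝ =>
      iteratedFDeriv ℝ i (fun ϑ : ℝ => jweight d q.1 * F (WithLp.ofLp (γ ϑ - jshift q.1))) q.2 := by
  set Φ : EuclideanSpace ℝ (Fin 2) × ℝ → ℝ := fun z => F (WithLp.ofLp (γ z.2 - z.1)) with hΦ
  set Lr : ℝ →L[ℝ] EuclideanSpace ℝ (Fin 2) × ℝ := ContinuousLinearMap.inr ℝ (EuclideanSpace ℝ (Fin 2)) ℝ with hLr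
  have hΦc : ContDiff ℝ 4 Φ := contDiff_curveTranslate hG hγ
  have hi' : (i : WithTop ℕ∞) ≤ 4 := by exact_mod_cast hi
  have heq : (fun q : (ℝ × ℝ) × ℝ => iteratedFDeriv ℝ i (fun ϑ : ℝ => jweight d q.1 * F (WithLp.ofLp (γ ϑ - jshift q.1))) q.2) =
      fun q : (ℝ × ℝ) × ℝ => jweight d q.1 •
        ContinuousMultilinearMap.compContinuousLinearMapL (fun _ : Fin i => Lr) (iteratedFDeriv ℝ i Φ (Lr q.2 + (jshift q.1, 0))) := by
    funext q
    have hcd : ContDiff ℝ i (fun ϑ : ℝ => F (WithLp.ofLp (γ ϑ - jshift q.1))) := (contDiff_comp_curve_sub hG hγ _).of_le hi'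
    have e1 : (fun ϑ : ℝ => jweight d q.1 * F (WithLp.ofLp (γ ϑ - jshift q.1))) =
        jweight d q.1 • fun ϑ : ℝ => F (WithLp.ofLp (γ ϑ - jshift q.1)) := by funext ϑ; simp [smul_eq_mul]
    rw [e1, iteratedFDeriv_const_smul_apply hcd.contDiffAt, iteratedFDeriv_comp_curve_sub_eq hG hγ _ hi]
    rfl
  rw [heq]
  refine ((continuous_jweight d).comp continuous_fst).smul ?_
  exact (ContinuousMultilinearMap.compContinuousLinearMapL fun _ : Fin i => Lr).continuous.comp
    ((hΦc.continuous_iteratedFDeriv hi').comp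
      ((Lr.continuous.comp continuous_snd).add ((continuous_jshift.comp continuous_fst).prodMk continuous_const)))

/-- **Differentiation under the smoothing integral along the curve**: `ϑ ↦ ∫ J̃J̃(w)·G(γϑ − v_w) dμ(w)` is `C⁴` and its iterated
Fréchet derivatives of order `≤ 4` are the integrals of those of the integrand. -/
theorem contDiff_integral_curveFamily (hG : ContDiff ℝ 4 (fun q : EuclideanSpace ℝ (Fin 2) => F (WithLp.ofLp q))) (hγ : ContDiff ℝ 4 γ) :
    ContDiff ℝ 4 (fun ϑ : ℝ => ∫ w, jweight d w * F (WithLp.ofLp (γ ϑ - jshift w)) ∂jmeas) ∧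
      ∀ j ≤ 4, ∀ ϑ : ℝ, iteratedFDeriv ℝ j (fun ϑ : ℝ => ∫ w, jweight d w * F (WithLp.ofLp (γ ϑ - jshift w)) ∂jmeas) ϑ =
        ∫ w, iteratedFDeriv ℝ j (fun ϑ : ℝ => jweight d w * F (WithLp.ofLp (γ ϑ - jshift w))) ϑ ∂jmeas := by
  have hs : ∀ w : ℝ × ℝ, ContDiff ℝ 4 (fun ϑ : ℝ => jweight d w * F (WithLp.ofLp (γ ϑ - jshift w))) := fun w =>
    contDiff_const.mul (contDiff_comp_curve_sub hG hγ (jshift w))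
  exact contDiff_integral_of_continuous_family (P := ℝ) (μ := jmeas) (m := 4) isCompact_jsquare (ae_jmeas_mem_Icc)
    (N := fun w ϑ => jweight d w * F (WithLp.ofLp (γ ϑ - jshift w))) hs
    (fun i hi => continuous_iteratedFDeriv_curveFamily d hG hγ hi)

/-- Continuity in `w` of `Dʲ[ϑ ↦ J̃J̃(w)·G(γϑ − v_w)](ϑ)` at a fixed `ϑ`, and its integrability on the smoothing square. -/
theorem integrable_iteratedFDeriv_curveFamily (hG : ContDiff ℝ 4 (fun q : EuclideanSpace ℝ (Fin 2) => F (WithLp.ofLp q))) (hγ : ContDiff ℝ 4 γ)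
    {j : ℕ} (hj : j ≤ 4) (ϑ : ℝ) :
    Integrable (fun w => iteratedFDeriv ℝ j (fun ϑ : ℝ => jweight d w * F (WithLp.ofLp (γ ϑ - jshift w))) ϑ) jmeas :=
  integrable_jmeas_of_continuous
    (continuous_iteratedFDeriv_family_left (P := ℝ) (N := fun w ϑ => jweight d w * F (WithLp.ofLp (γ ϑ - jshift w)))
      (continuous_iteratedFDeriv_curveFamily d hG hγ hj) ϑ)

/-- The integrand's `iteratedDeriv` at order `j ≤ 4`: `(Dʲ[ϑ ↦ J̃J̃(w)·G(γϑ − v_w)](ϑ))(1,…,1) = J̃J̃(w)·∂ʲ[ϑ ↦ G(γϑ − v_w)](ϑ)`. -/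
theorem iteratedFDeriv_curveFamily_apply_one (hG : ContDiff ℝ 4 (fun q : EuclideanSpace ℝ (Fin 2) => F (WithLp.ofLp q))) (hγ : ContDiff ℝ 4 γ)
    {j : ℕ} (hj : j ≤ 4) (ϑ : ℝ) (w : ℝ × ℝ) :
    (iteratedFDeriv ℝ j (fun ϑ : ℝ => jweight d w * F (WithLp.ofLp (γ ϑ - jshift w))) ϑ) (fun _ => (1 : ℝ)) =
      jweight d w * iteratedDeriv j (fun ϑ : ℝ => F (WithLp.ofLp (γ ϑ - jshift w))) ϑ := by
  have hj' : (j : WithTop ℕ∞) ≤ 4 := by exact_mod_cast hj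
  rw [← iteratedDeriv_eq_iteratedFDeriv]
  exact iteratedDeriv_const_mul (jweight d w) (((contDiff_comp_curve_sub hG hγ (jshift w)).of_le hj').contDiffAt)

/-- Integrability of `w ↦ J̃J̃(w)·∂ʲ[ϑ ↦ G(γϑ − v_w)](ϑ)` on the smoothing square (`j ≤ 4`). -/
theorem integrable_jweight_mul_iteratedDeriv_comp_curve_sub (hG : ContDiff ℝ 4 (fun q : EuclideanSpace ℝ (Fin 2) => F (WithLp.ofLp q)))
    (hγ : ContDiff ℝ 4 γ) {j : ℕ} (hj : j ≤ 4) (ϑ : ℝ) :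
    Integrable (fun w => jweight d w * iteratedDeriv j (fun ϑ : ℝ => F (WithLp.ofLp (γ ϑ - jshift w))) ϑ) jmeas := by
  have h := (ContinuousMultilinearMap.apply ℝ (fun _ : Fin j => ℝ) ℝ (fun _ => (1 : ℝ))).integrable_comp
    (integrable_iteratedFDeriv_curveFamily d hG hγ hj ϑ)
  refine h.congr (Eventually.of_forall fun w => ?_)
  show (ContinuousMultilinearMap.apply ℝ (fun _ : Fin j => ℝ) ℝ (fun _ => (1 : ℝ)))
      (iteratedFDeriv ℝ j (fun ϑ : ℝ => jweight d w * F (WithLp.ofLp (γ ϑ - jshift w))) ϑ) = _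
  rw [ContinuousMultilinearMap.apply_apply, iteratedFDeriv_curveFamily_apply_one d hG hγ hj]

/-- The `iteratedDeriv` form: `∂ʲ[ϑ ↦ ∫ J̃J̃(w)·G(γϑ − v_w)](ϑ) = ∫ J̃J̃(w)·∂ʲ[ϑ ↦ G(γϑ − v_w)](ϑ) dμ(w)`, `j ≤ 4`. -/
theorem iteratedDeriv_integral_curveFamily (hG : ContDiff ℝ 4 (fun q : EuclideanSpace ℝ (Fin 2) => F (WithLp.ofLp q))) (hγ : ContDiff ℝ 4 γ)
    {j : ℕ} (hj : j ≤ 4) (ϑ : ℝ) :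
    iteratedDeriv j (fun ϑ : ℝ => ∫ w, jweight d w * F (WithLp.ofLp (γ ϑ - jshift w)) ∂jmeas) ϑ =
      ∫ w, jweight d w * iteratedDeriv j (fun ϑ : ℝ => F (WithLp.ofLp (γ ϑ - jshift w))) ϑ ∂jmeas := by
  calc iteratedDeriv j (fun ϑ : ℝ => ∫ w, jweight d w * F (WithLp.ofLp (γ ϑ - jshift w)) ∂jmeas) ϑ
      = (iteratedFDeriv ℝ j (fun ϑ : ℝ => ∫ w, jweight d w * F (WithLp.ofLp (γ ϑ - jshift w)) ∂jmeas) ϑ) (fun _ => (1 : ℝ)) :=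
        iteratedDeriv_eq_iteratedFDeriv
    _ = (∫ w, iteratedFDeriv ℝ j (fun ϑ : ℝ => jweight d w * F (WithLp.ofLp (γ ϑ - jshift w))) ϑ ∂jmeas) (fun _ => (1 : ℝ)) := by
        rw [(contDiff_integral_curveFamily d hG hγ).2 j hj ϑ]
    _ = ∫ w, (iteratedFDeriv ℝ j (fun ϑ : ℝ => jweight d w * F (WithLp.ofLp (γ ϑ - jshift w))) ϑ) (fun _ => (1 : ℝ)) ∂jmeas :=
        ContinuousMultilinearMap.integral_apply (integrable_iteratedFDeriv_curveFamily d hG hγ hj ϑ) _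
    _ = ∫ w, jweight d w * iteratedDeriv j (fun ϑ : ℝ => F (WithLp.ofLp (γ ϑ - jshift w))) ϑ ∂jmeas :=
        integral_congr_ae (Eventually.of_forall fun w => iteratedFDeriv_curveFamily_apply_one d hG hγ hj ϑ w)

/-- The Jackson mean read along the curve IS the integral of the family. -/
theorem jsmooth_comp_curve_eq_integral (hF : Continuous F) :
    (fun ϑ : ℝ => jsmooth d F (WithLp.ofLp (γ ϑ))) = fun ϑ : ℝ => ∫ w, jweight d w * F (WithLp.ofLp (γ ϑ - jshift w)) ∂jmeas := by
  funext ϑ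
  rw [jsmooth_eq_integral_translate d hF (γ ϑ)]
  rfl

/-- **The remainder along the curve is `C⁴`** — without any global size hypothesis (v1's `contDiff_jhigh1_comp_curve` needed `‖DⁱG‖ ≤ Bᵢ`). -/
theorem contDiff_jhigh1_comp_curve' (hF : Continuous F) (hG : ContDiff ℝ 4 (fun q : EuclideanSpace ℝ (Fin 2) => F (WithLp.ofLp q)))
    (hγ : ContDiff ℝ 4 γ) :
    ContDiff ℝ 4 ((fun q : EuclideanSpace ℝ (Fin 2) => jhigh1 d F (WithLp.ofLp q)) ∘ γ) := by
  have e : ((fun q : EuclideanSpace ℝ (Fin 2) => jhigh1 d F (WithLp.ofLp q)) ∘ γ) =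
      (fun ϑ : ℝ => F (WithLp.ofLp (γ ϑ))) - fun ϑ : ℝ => jsmooth d F (WithLp.ofLp (γ ϑ)) := by
    funext ϑ; simp [jhigh1]
  rw [e, jsmooth_comp_curve_eq_integral d hF]
  exact (hG.comp hγ).sub (contDiff_integral_curveFamily d hG hγ).1

/-- **THE EXACT FORMULA (v2 door, core)**: for `k ≤ 4`,
`∂ᵏ[(F − 𝒥_dF) ∘ ofLp ∘ γ](θ) = −∫ J̃J̃(w)·(∂ᵏ[ϑ ↦ G(γϑ − v_w)](θ) − ∂ᵏ[G ∘ γ](θ)) dμ(w)` — the hypothesis-free twin of k3c3-p3's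
`iteratedDeriv_jhigh1_comp_curve_eq` (p540131; there: global sizes of `G` and θ-uniform curve jets for the domination — here automatic by §1). -/
theorem iteratedDeriv_jhigh1_comp_curve_eq' (hF : Continuous F) (hG : ContDiff ℝ 4 (fun q : EuclideanSpace ℝ (Fin 2) => F (WithLp.ofLp q)))
    (hγ : ContDiff ℝ 4 γ) {k : ℕ} (hk : k ≤ 4) (θ : ℝ) :
    iteratedDeriv k ((fun q : EuclideanSpace ℝ (Fin 2) => jhigh1 d F (WithLp.ofLp q)) ∘ γ) θ =
      -∫ w, jweight d w * (iteratedDeriv k (fun ϑ : ℝ => F (WithLp.ofLp (γ ϑ - jshift w))) θ -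
        iteratedDeriv k (fun ϑ : ℝ => F (WithLp.ofLp (γ ϑ))) θ) ∂jmeas := by
  have hk' : (k : WithTop ℕ∞) ≤ 4 := by exact_mod_cast hk
  have e : ((fun q : EuclideanSpace ℝ (Fin 2) => jhigh1 d F (WithLp.ofLp q)) ∘ γ) =
      (fun ϑ : ℝ => F (WithLp.ofLp (γ ϑ))) - fun ϑ : ℝ => jsmooth d F (WithLp.ofLp (γ ϑ)) := by
    funext ϑ; simp [jhigh1]
  have hI := contDiff_integral_curveFamily d hG hγ
  have hGγ : ContDiff ℝ 4 (fun ϑ : ℝ => F (WithLp.ofLp (γ ϑ))) := hG.comp hγ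
  rw [e, jsmooth_comp_curve_eq_integral d hF, iteratedDeriv_sub (hGγ.of_le hk').contDiffAt (hI.1.of_le hk').contDiffAt,
    iteratedDeriv_integral_curveFamily d hG hγ hk θ]
  set c : ℝ := iteratedDeriv k (fun ϑ : ℝ => F (WithLp.ofLp (γ ϑ))) θ with hc
  set g : ℝ × ℝ → ℝ := fun w => iteratedDeriv k (fun ϑ : ℝ => F (WithLp.ofLp (γ ϑ - jshift w))) θ with hg
  have i1 : Integrable (fun w => jweight d w * g w) jmeas := integrable_jweight_mul_iteratedDeriv_comp_curve_sub d hG hγ hk θ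
  have i2 : Integrable (fun w => jweight d w * c) jmeas := (integrable_jmeas_of_continuous (continuous_jweight d)).mul_const c
  have e2 : (fun w => jweight d w * (g w - c)) = fun w => jweight d w * g w - jweight d w * c := funext fun w => by ring
  rw [e2, integral_sub i1 i2, integral_mul_const, integral_jweight, one_mul]; ring

/-! ## §3 The majorant form and the near/far bookkeeping -/

/-- **MAJORANT FORM (v2 door)**: if `maj` dominates the along-curve displaced difference
`|∂ᵏ[ϑ ↦ G(γϑ − v_w)](θ) − ∂ᵏ[G∘γ](θ)|` on the smoothing square `[−π, π]²` and `J̃J̃·maj` is integrable, then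
`|∂ᵏ[(F − 𝒥_dF) ∘ ofLp ∘ γ](θ)| ≤ ∫ J̃J̃·maj dμ` (`k ≤ 4`). -/
theorem abs_iteratedDeriv_jhigh1_comp_curve_le_integral (hF : Continuous F)
    (hG : ContDiff ℝ 4 (fun q : EuclideanSpace ℝ (Fin 2) => F (WithLp.ofLp q))) (hγ : ContDiff ℝ 4 γ) {k : ℕ} (hk : k ≤ 4) (θ : ℝ)
    {maj : ℝ × ℝ → ℝ} (hint : Integrable (fun w => jweight d w * maj w) jmeas)
    (hmaj : ∀ w ∈ Set.Icc (-π) π ×ˢ Set.Icc (-π) π,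
      |iteratedDeriv k (fun ϑ : ℝ => F (WithLp.ofLp (γ ϑ - jshift w))) θ - iteratedDeriv k (fun ϑ : ℝ => F (WithLp.ofLp (γ ϑ))) θ| ≤ maj w) :
    |iteratedDeriv k ((fun q : EuclideanSpace ℝ (Fin 2) => jhigh1 d F (WithLp.ofLp q)) ∘ γ) θ| ≤ ∫ w, jweight d w * maj w ∂jmeas := by
  rw [iteratedDeriv_jhigh1_comp_curve_eq' d hF hG hγ hk θ, abs_neg, ← Real.norm_eq_abs]
  refine norm_integral_le_of_norm_le hint (ae_jmeas_mem_Icc.mono fun w hw => ?_)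
  rw [Real.norm_eq_abs, abs_mul, abs_of_nonneg (jweight_nonneg d w)]
  exact mul_le_mul_of_nonneg_left (hmaj w hw) (jweight_nonneg d w)

/-- **NEAR/FAR BOOKKEEPING (v2 door)**: if the displaced difference is `≤ A(|s| + |t|) + C` on the near square `|s|, |t| ≤ δ` and `≤ S` on the
rest of `[−π, π]²` (`A, C, S ≥ 0`), then for any first-moment bound `∫J̃J̃(|s|+|t|) ≤ m₁` (`3π/(d+1)`, or k3c3-p3's `π√3/(d+1)`):
`|∂ᵏ[(F − 𝒥_dF) ∘ ofLp ∘ γ](θ)| ≤ A·m₁ + C + S·π³/((d+1)δ)³`. -/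
theorem abs_iteratedDeriv_jhigh1_comp_curve_le_split (hF : Continuous F)
    (hG : ContDiff ℝ 4 (fun q : EuclideanSpace ℝ (Fin 2) => F (WithLp.ofLp q))) (hγ : ContDiff ℝ 4 γ) {k : ℕ} (hk : k ≤ 4) (θ : ℝ)
    {δ A C S : ℝ} (hδ : 0 < δ) (hδπ : δ ≤ π) (hA : 0 ≤ A) (hC : 0 ≤ C) (hS : 0 ≤ S)
    (hnear : ∀ w : ℝ × ℝ, |w.1| ≤ δ → |w.2| ≤ δ →
      |iteratedDeriv k (fun ϑ : ℝ => F (WithLp.ofLp (γ ϑ - jshift w))) θ - iteratedDeriv k (fun ϑ : ℝ => F (WithLp.ofLp (γ ϑ))) θ| ≤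
        A * (|w.1| + |w.2|) + C)
    (hfar : ∀ w ∈ Set.Icc (-π) π ×ˢ Set.Icc (-π) π, (δ < |w.1| ∨ δ < |w.2|) →
      |iteratedDeriv k (fun ϑ : ℝ => F (WithLp.ofLp (γ ϑ - jshift w))) θ - iteratedDeriv k (fun ϑ : ℝ => F (WithLp.ofLp (γ ϑ))) θ| ≤ S)
    {m₁ : ℝ} (hm₁ : ∫ w, jweight d w * (|w.1| + |w.2|) ∂jmeas ≤ m₁) :
    |iteratedDeriv k ((fun q : EuclideanSpace ℝ (Fin 2) => jhigh1 d F (WithLp.ofLp q)) ∘ γ) θ| ≤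
      A * m₁ + C + S * (π ^ 3 / ((d + 1) * δ) ^ 3) := by
  set maj : ℝ × ℝ → ℝ := fun w => A * (|w.1| + |w.2|) + C +
    S * (Set.indicator {s : ℝ | δ < |s|} (1 : ℝ → ℝ) w.1 + Set.indicator {s : ℝ | δ < |s|} (1 : ℝ → ℝ) w.2) with hmaj
  -- integrability of `J̃J̃ · maj`
  have i1 : Integrable (fun w : ℝ × ℝ => A * (jweight d w * (|w.1| + |w.2|))) jmeas :=
    (integrable_jmeas_of_continuous ((continuous_jweight d).mul (continuous_fst.abs.add continuous_snd.abs))).const_mul _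
  have i2 : Integrable (fun w : ℝ × ℝ => jweight d w * C) jmeas := (integrable_jmeas_of_continuous (continuous_jweight d)).mul_const _
  have i3 : Integrable (fun w : ℝ × ℝ => S * (jweight d w *
      (Set.indicator {s : ℝ | δ < |s|} (1 : ℝ → ℝ) w.1 + Set.indicator {s : ℝ | δ < |s|} (1 : ℝ → ℝ) w.2))) jmeas := by
    have := ((integrable_jweight_mul_jfar_fst d δ).add (integrable_jweight_mul_jfar_snd d δ)).const_mul S
    refine this.congr (Eventually.of_forall fun w => ?_)
    show S * (jweight d w * Set.indicator {s : ℝ | δ < |s|} (1 : ℝ → ℝ) w.1 + jweight d w * Set.indicator {s : ℝ | δ < |s|} (1 : ℝ → ℝ) w.2) = _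
    ring
  have e : (fun w => jweight d w * maj w) = fun w => A * (jweight d w * (|w.1| + |w.2|)) + jweight d w * C +
      S * (jweight d w * (Set.indicator {s : ℝ | δ < |s|} (1 : ℝ → ℝ) w.1 + Set.indicator {s : ℝ | δ < |s|} (1 : ℝ → ℝ) w.2)) := by
    funext w; simp only [hmaj]; ring
  have hint : Integrable (fun w => jweight d w * maj w) jmeas := by rw [e]; exact (i1.add i2).add i3
  -- the majorant property on the square
  have hM : ∀ w ∈ Set.Icc (-π) π ×ˢ Set.Icc (-π) π,
      |iteratedDeriv k (fun ϑ : ℝ => F (WithLp.ofLp (γ ϑ - jshift w))) θ - iteratedDeriv k (fun ϑ : ℝ => F (WithLp.ofLp (γ ϑ))) θ| ≤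
        maj w := by
    intro w hw
    have hind0 : 0 ≤ Set.indicator {s : ℝ | δ < |s|} (1 : ℝ → ℝ) w.1 + Set.indicator {s : ℝ | δ < |s|} (1 : ℝ → ℝ) w.2 :=
      add_nonneg (jfar_nonneg _ _) (jfar_nonneg _ _)
    by_cases hnw : |w.1| ≤ δ ∧ |w.2| ≤ δ
    · calc _ ≤ A * (|w.1| + |w.2|) + C := hnear w hnw.1 hnw.2
        _ ≤ maj w := le_add_of_nonneg_right (mul_nonneg hS hind0)
    · have hor : δ < |w.1| ∨ δ < |w.2| := by
        rcases not_and_or.mp hnw with h1 | h2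
        · exact Or.inl (not_le.mp h1)
        · exact Or.inr (not_le.mp h2)
      have hind : (1 : ℝ) ≤ Set.indicator {s : ℝ | δ < |s|} (1 : ℝ → ℝ) w.1 + Set.indicator {s : ℝ | δ < |s|} (1 : ℝ → ℝ) w.2 := by
        rcases hor with h1 | h2
        · rw [jfar_eq_one h1]; linarith [jfar_nonneg δ w.2]
        · rw [jfar_eq_one h2]; linarith [jfar_nonneg δ w.1]
      calc _ ≤ S := hfar w hw hor
        _ ≤ S * (Set.indicator {s : ℝ | δ < |s|} (1 : ℝ → ℝ) w.1 + Set.indicator {s : ℝ | δ < |s|} (1 : ℝ → ℝ) w.2) :=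
            le_mul_of_one_le_right hS hind
        _ ≤ maj w := by
            have : 0 ≤ A * (|w.1| + |w.2|) + C := add_nonneg (mul_nonneg hA (add_nonneg (abs_nonneg _) (abs_nonneg _))) hC
            simp only [hmaj]; linarith
  refine (abs_iteratedDeriv_jhigh1_comp_curve_le_integral d hF hG hγ hk θ hint hM).trans ?_
  have i12 : Integrable (fun w : ℝ × ℝ => A * (jweight d w * (|w.1| + |w.2|)) + jweight d w * C) jmeas := i1.add i2
  rw [e, integral_add i12 i3, integral_add i1 i2, integral_const_mul, integral_mul_const, integral_const_mul, integral_jweight,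
    one_mul]
  have h3 := integral_jweight_mul_jfar_le d hδ hδπ
  nlinarith [mul_le_mul_of_nonneg_left hm₁ hA, mul_le_mul_of_nonneg_left h3 hS]


end Curve

end Summit.HubbardSuperconductivity.HubbardSuperconductivity.Theorems.KLRegimeSplit

end
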